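import Summits.CriticalPhenomena.PercolationContinuityZ3.Theorems.PercNearOneGluingNoHeavyLowerTailSunflowerTBernScheme
import HarnessLib

/-!
# `NoHeavyLowerTail` (crux stmt-CriticalPhenomena-4575), abstract sunflower cubic: T-BERN FOR TWO PETALS

Support file (seat `prim-ineq-prove-1` gen 63; `--supports stmt-CriticalPhenomena-4575`).  No `sorry`, no named facts, no
conjecture-shaped hypotheses.  Memo: run/shared/lean/prim/prim-ineq-prove-1/FINDING-CONVEX-prove1-g63.md §3.

`TBern s b β V` (`…SunflowerTBern`) at `n = 2` is the single inequality
  **`A₁g₂ + A₂g₁ ≤ a₀ + A₀V`**,  `A_i = s + (1−s)u_i`, `g_i = (1−s)m_i + s·vv_i`, `A₀ = s + (1−s)b`, `a₀ = (1−s)b + sβ`,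
for two petals with `b ≤ u_i ≤ 1`, `β ≤ vv_i`, `b ≤ m_i ≤ min(u_i, vv_i)`, `u₁u₂ ≤ b`, `vv₁vv₂ ≤ βV`, `g₁g₂ ≤ a₀V` (the two outer
coefficients `A₁A₂ ≤ A₀`, `g₁g₂ ≤ a₀V` being the one-coin bound and the `g`-budget).  It was known only by a vertex enumeration
(g52, paper); here is a certificate-style proof (`k1_pair`), division-free:
* `A₀a₀(A₁g₂ + A₂g₁) = a₀²A₁A₂ + A₀²g₁g₂ − P₁P₂` with the ALIGNMENT SIGNS `P_i = a₀A_i − A₀g_i` (`pair_identity`); an aligned pair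
  (`P₁P₂ ≥ 0`) is immediate;
* for a misaligned pair (`P₁ ≥ 0 ≥ P₂`): `P₁ ≤ a₀(1−s)(u₁−b)`, `b(−P₂) ≤ s·a₀(u₂−b) + s·A₀(b·vv₂ − β·u₂)` (x-part + z-part of the
  misalignment); the x-part is paid by the ONE-COIN DEFECT `b(A₀ − A₁A₂) = s(1−s)(u₁−b)(u₂−b) + (1−s)A₀(b − u₁u₂)`
  (`one_coin_pair`), the z-part (present only when `b·vv₂ > β·u₂`) by the `g`-slack, through
  `β(a₀V − g₁g₂) ≥ (1−s)vv₁(b·vv₂ − β·u₂) + sβ·vv₂(vv₁ − g₁)` and the key parameter inequality `s ≤ A₀` (`k1_pair_misaligned`).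
Consequences: `coefDom_pair` (the `CoefDom` certificate of a two-petal family against `(A₀X + a₀)(X + V)`, via `coefDom_step`) and
**`tbern_fin_two`**: the conclusion of `TBern s b β V` for every admissible family on `Fin 2`.  This is the base case of the
floor-induction of the memo (§2) and the model for its 2-body endgames.
-/

noncomputable section

namespace Summit.CriticalPhenomena.PercolationContinuityZ3.Theorems.SunflowerPartition

namespace SafeCalc

namespace LinkedCurrency

open Finset Polynomial

/-- The pair identity: `A₀a₀(A₁g₂ + A₂g₁) = a₀²A₁A₂ + A₀²g₁g₂ − P₁P₂` with `P_i = a₀A_i − A₀g_i`. [this work] -/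
theorem pair_identity (A₀ a₀ A₁ A₂ g₁ g₂ : ℝ) :
    A₀ * a₀ * (A₁ * g₂ + A₂ * g₁) =
      a₀ ^ 2 * (A₁ * A₂) + A₀ ^ 2 * (g₁ * g₂) - (a₀ * A₁ - A₀ * g₁) * (a₀ * A₂ - A₀ * g₂) := by
  ring

/-- **One-coin defect, exact**: `b(A₀ − A₁A₂) = s(1−s)(u₁−b)(u₂−b) + (1−s)A₀(b − u₁u₂)`. [this work] -/
theorem one_coin_pair (s b u₁ u₂ : ℝ) :
    b * ((s + (1 - s) * b) - (s + (1 - s) * u₁) * (s + (1 - s) * u₂)) =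
      s * (1 - s) * (u₁ - b) * (u₂ - b) + (1 - s) * (s + (1 - s) * b) * (b - u₁ * u₂) := by
  ring

/-- One-coin bound for a pair: `A₁A₂ ≤ A₀` when `u₁u₂ ≤ b`, `b ≤ u_i ≤ 1`. [this work] -/
theorem A_pair_le {s b u₁ u₂ : ℝ} (hb : 0 < b) (hs0 : 0 ≤ s) (hs1 : s ≤ 1) (hu₁ : b ≤ u₁) (hu₂ : b ≤ u₂)
    (hu₁1 : u₁ ≤ 1) (hpu : u₁ * u₂ ≤ b) :
    (s + (1 - s) * u₁) * (s + (1 - s) * u₂) ≤ s + (1 - s) * b := by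
  have hs' : 0 ≤ 1 - s := sub_nonneg.2 hs1
  have hb1 : b ≤ 1 := by nlinarith
  have hA₀ : 0 ≤ s + (1 - s) * b := by positivity
  have key := one_coin_pair s b u₁ u₂
  have h1 : 0 ≤ s * (1 - s) * (u₁ - b) * (u₂ - b) :=
    mul_nonneg (mul_nonneg (mul_nonneg hs0 hs') (sub_nonneg.2 hu₁)) (sub_nonneg.2 hu₂)
  have h2 : 0 ≤ (1 - s) * (s + (1 - s) * b) * (b - u₁ * u₂) := mul_nonneg (mul_nonneg hs' hA₀) (sub_nonneg.2 hpu)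
  nlinarith

/-- **The misaligned pair**: if petal 1 is `u`-heavy (`P₁ ≥ 0`) then `−P₁P₂ ≤ a₀²(A₀ − A₁A₂) + A₀²(a₀V − g₁g₂)` (whatever the
sign of `P₂`; for `P₂ ≤ 0` this is the misaligned case of `k1_pair`). [this work] -/
theorem k1_pair_misaligned {s b β V u₁ u₂ v₁ v₂ m₁ m₂ : ℝ} (hb : 0 < b) (hbβ : b ≤ β) (hs0 : 0 ≤ s) (hs1 : s ≤ 1)
    (hu₁1 : u₁ ≤ 1) (hu₂ : b ≤ u₂) (hv₁ : β ≤ v₁) (hv₂ : β ≤ v₂)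
    (hm₁ : b ≤ m₁) (hm₁v : m₁ ≤ v₁) (hm₂u : m₂ ≤ u₂)
    (hpu : u₁ * u₂ ≤ b) (hpv : v₁ * v₂ ≤ β * V)
    (hpg : ((1 - s) * m₁ + s * v₁) * ((1 - s) * m₂ + s * v₂) ≤ ((1 - s) * b + s * β) * V)
    (hP₁ : 0 ≤ ((1 - s) * b + s * β) * (s + (1 - s) * u₁) - (s + (1 - s) * b) * ((1 - s) * m₁ + s * v₁)) :
    -((((1 - s) * b + s * β) * (s + (1 - s) * u₁) - (s + (1 - s) * b) * ((1 - s) * m₁ + s * v₁)) *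
        (((1 - s) * b + s * β) * (s + (1 - s) * u₂) - (s + (1 - s) * b) * ((1 - s) * m₂ + s * v₂))) ≤
      ((1 - s) * b + s * β) ^ 2 * ((s + (1 - s) * b) - (s + (1 - s) * u₁) * (s + (1 - s) * u₂)) +
        (s + (1 - s) * b) ^ 2 * (((1 - s) * b + s * β) * V - ((1 - s) * m₁ + s * v₁) * ((1 - s) * m₂ + s * v₂)) := by
  -- names
  set A₀ : ℝ := s + (1 - s) * b with hA₀
  set a₀ : ℝ := (1 - s) * b + s * β with ha₀
  set A₁ : ℝ := s + (1 - s) * u₁ with hA₁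
  set A₂ : ℝ := s + (1 - s) * u₂ with hA₂
  set g₁ : ℝ := (1 - s) * m₁ + s * v₁ with hg₁
  set g₂ : ℝ := (1 - s) * m₂ + s * v₂ with hg₂
  set P₁ : ℝ := a₀ * A₁ - A₀ * g₁ with hP₁d
  set P₂ : ℝ := a₀ * A₂ - A₀ * g₂ with hP₂d
  have hs' : 0 ≤ 1 - s := sub_nonneg.2 hs1
  have hβ : 0 < β := hb.trans_le hbβ
  have hu₂0 : 0 ≤ u₂ := hb.le.trans hu₂
  have hv₁0 : 0 ≤ v₁ := hβ.le.trans hv₁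
  have hv₂0 : 0 ≤ v₂ := hβ.le.trans hv₂
  have hsb : 0 ≤ (1 - s) * b := mul_nonneg hs' hb.le
  have hA₀0 : 0 ≤ A₀ := by rw [hA₀]; linarith
  have hsA₀ : s ≤ A₀ := by rw [hA₀]; linarith
  have ha₀0 : 0 < a₀ := by
    have : 0 ≤ s * (β - b) := mul_nonneg hs0 (sub_nonneg.2 hbβ)
    have e : a₀ = b + s * (β - b) := by rw [ha₀]; ring
    rw [e]; linarith
  have hA₁1 : A₁ ≤ 1 := by
    have := mul_le_mul_of_nonneg_left hu₁1 hs'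
    rw [hA₁]; linarith
  have hg₁0 : 0 ≤ g₁ := by
    have h1 : 0 ≤ (1 - s) * m₁ := mul_nonneg hs' (hb.le.trans hm₁)
    have h2 : 0 ≤ s * v₁ := mul_nonneg hs0 hv₁0
    rw [hg₁]; linarith
  have hg₁v : g₁ ≤ v₁ := by
    have := mul_le_mul_of_nonneg_left hm₁v hs'
    rw [hg₁]; linarith
  have hg₁a : a₀ ≤ g₁ := by
    have h1 := mul_le_mul_of_nonneg_left hm₁ hs'
    have h2 := mul_le_mul_of_nonneg_left hv₁ hs0
    rw [hg₁, ha₀]; linarith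
  -- (1) P₁ ≤ a₀(1−s)(u₁−b)
  have hP₁le : P₁ ≤ a₀ * (1 - s) * (u₁ - b) := by
    have h1 : A₀ * a₀ ≤ A₀ * g₁ := mul_le_mul_of_nonneg_left hg₁a hA₀0
    have h3 : a₀ * A₁ - A₀ * a₀ = a₀ * (1 - s) * (u₁ - b) := by rw [hA₁, hA₀]; ring
    rw [hP₁d]; linarith
  -- (2) b(−P₂) ≤ s·a₀(u₂−b) + s·A₀(b v₂ − β u₂)   (an identity after m₂ ≤ u₂)
  have hQ₂ : b * (-P₂) ≤ s * a₀ * (u₂ - b) + s * A₀ * (b * v₂ - β * u₂) := by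
    have h0 : A₀ * ((1 - s) * m₂) ≤ A₀ * ((1 - s) * u₂) :=
      mul_le_mul_of_nonneg_left (mul_le_mul_of_nonneg_left hm₂u hs') hA₀0
    have h1 : -P₂ ≤ A₀ * ((1 - s) * u₂ + s * v₂) - a₀ * A₂ := by
      have e : -P₂ = A₀ * ((1 - s) * m₂) + A₀ * (s * v₂) - a₀ * A₂ := by rw [hP₂d, hg₂]; ring
      rw [e]; linarith
    have h2 : b * (A₀ * ((1 - s) * u₂ + s * v₂) - a₀ * A₂) = s * a₀ * (u₂ - b) + s * A₀ * (b * v₂ - β * u₂) := by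
      rw [hA₀, ha₀, hA₂]; ring
    have h3 := mul_le_mul_of_nonneg_left h1 hb.le
    rw [h2] at h3
    exact h3
  -- (3) the x-part is paid by the one-coin defect
  have hX : P₁ * (s * a₀ * (u₂ - b)) ≤ a₀ ^ 2 * (b * (A₀ - A₁ * A₂)) := by
    have hc : 0 ≤ s * a₀ * (u₂ - b) := mul_nonneg (mul_nonneg hs0 ha₀0.le) (sub_nonneg.2 hu₂)
    have h1 : P₁ * (s * a₀ * (u₂ - b)) ≤ (a₀ * (1 - s) * (u₁ - b)) * (s * a₀ * (u₂ - b)) :=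
      mul_le_mul_of_nonneg_right hP₁le hc
    have h2 : a₀ ^ 2 * (b * (A₀ - A₁ * A₂)) =
        (a₀ * (1 - s) * (u₁ - b)) * (s * a₀ * (u₂ - b)) + a₀ ^ 2 * ((1 - s) * A₀ * (b - u₁ * u₂)) := by
      rw [hA₀, hA₁, hA₂]; ring
    have h3 : 0 ≤ a₀ ^ 2 * ((1 - s) * A₀ * (b - u₁ * u₂)) :=
      mul_nonneg (sq_nonneg _) (mul_nonneg (mul_nonneg hs' hA₀0) (sub_nonneg.2 hpu))
    rw [h2]; linarith
  -- (4) the z-part (if any) is paid by the g-slack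
  have hZ : P₁ * (s * A₀ * (b * v₂ - β * u₂)) ≤ A₀ ^ 2 * (b * (a₀ * V - g₁ * g₂)) := by
    have hroom : 0 ≤ A₀ ^ 2 * (b * (a₀ * V - g₁ * g₂)) :=
      mul_nonneg (sq_nonneg _) (mul_nonneg hb.le (sub_nonneg.2 hpg))
    rcases le_or_gt (b * v₂) (β * u₂) with hle | hgt
    · -- no z-part: left side ≤ 0 ≤ right side
      have h1 : P₁ * (s * A₀ * (b * v₂ - β * u₂)) ≤ 0 :=
        mul_nonpos_of_nonneg_of_nonpos hP₁ (mul_nonpos_of_nonneg_of_nonpos (mul_nonneg hs0 hA₀0) (sub_nonpos.2 hle))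
      exact h1.trans hroom
    · -- z-part present.  (a) g-slack from the z-budget: β(a₀V − g₁g₂) ≥ (1−s)v₁(bv₂−βu₂) + sβv₂(v₁−g₁)
      have hpos : 0 ≤ b * v₂ - β * u₂ := (sub_pos.2 hgt).le
      have hgs : (1 - s) * v₁ * (b * v₂ - β * u₂) + s * β * v₂ * (v₁ - g₁) ≤ β * (a₀ * V - g₁ * g₂) := by
        have e1 : a₀ * (v₁ * v₂) ≤ a₀ * (β * V) := mul_le_mul_of_nonneg_left hpv ha₀0.le
        have e2a : g₂ ≤ (1 - s) * u₂ + s * v₂ := by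
          have := mul_le_mul_of_nonneg_left hm₂u hs'
          rw [hg₂]; linarith
        have e2 : β * g₁ * g₂ ≤ β * g₁ * ((1 - s) * u₂ + s * v₂) :=
          mul_le_mul_of_nonneg_left e2a (mul_nonneg hβ.le hg₁0)
        have e3 : a₀ * (v₁ * v₂) - β * g₁ * ((1 - s) * u₂ + s * v₂) =
            (1 - s) * v₁ * (b * v₂ - β * u₂) + (1 - s) * (β * u₂ * (v₁ - g₁)) + s * β * v₂ * (v₁ - g₁) := by
          rw [ha₀]; ring
        have e4 : 0 ≤ (1 - s) * (β * u₂ * (v₁ - g₁)) :=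
          mul_nonneg hs' (mul_nonneg (mul_nonneg hβ.le hu₂0) (sub_nonneg.2 hg₁v))
        have e5 : β * (a₀ * V - g₁ * g₂) = a₀ * (β * V) - β * g₁ * g₂ := by ring
        rw [e5]; linarith
      -- (b) split P₁ = (a₀A₁ − A₀v₁) + A₀(v₁ − g₁)
      -- part (i): (a₀A₁ − A₀v₁)·sβ ≤ bA₀(1−s)v₁  (from sβA₁ ≤ sβ ≤ A₀β ≤ A₀v₁)
      have hi : (a₀ * A₁ - A₀ * v₁) * (s * β) ≤ b * A₀ * (1 - s) * v₁ := by
        have h1a : s * β * A₁ ≤ s * β * 1 := mul_le_mul_of_nonneg_left hA₁1 (mul_nonneg hs0 hβ.le)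
        have h1b : s * β ≤ A₀ * β := mul_le_mul_of_nonneg_right hsA₀ hβ.le
        have h1c : A₀ * β ≤ A₀ * v₁ := mul_le_mul_of_nonneg_left hv₁ hA₀0
        have h1 : s * β * A₁ ≤ A₀ * v₁ := by linarith
        have h2 : (a₀ * A₁ - A₀ * v₁) * (s * β) - b * A₀ * (1 - s) * v₁ = a₀ * (s * β * A₁ - A₀ * v₁) := by
          rw [ha₀]; ring
        have h4 : a₀ * (s * β * A₁ - A₀ * v₁) ≤ 0 := mul_nonpos_of_nonneg_of_nonpos ha₀0.le (by linarith)
        linarith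
      have hi' : (a₀ * A₁ - A₀ * v₁) * (s * β) * (b * v₂ - β * u₂) ≤ b * A₀ * (1 - s) * v₁ * (b * v₂ - β * u₂) :=
        mul_le_mul_of_nonneg_right hi hpos
      -- part (ii): A₀(v₁−g₁)·sβ·(bv₂ − βu₂) ≤ bA₀·sβv₂(v₁−g₁)
      have hii : A₀ * (v₁ - g₁) * (s * β) * (b * v₂ - β * u₂) ≤ A₀ * (v₁ - g₁) * (s * β) * (b * v₂) := by
        have h1 : b * v₂ - β * u₂ ≤ b * v₂ := by
          have := mul_nonneg hβ.le hu₂0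
          linarith
        exact mul_le_mul_of_nonneg_left h1 (mul_nonneg (mul_nonneg hA₀0 (sub_nonneg.2 hg₁v)) (mul_nonneg hs0 hβ.le))
      -- assemble: β·[P₁ s (bv₂−βu₂)] ≤ β·[b A₀ (a₀V − g₁g₂)]
      have hsum := mul_le_mul_of_nonneg_left hgs (mul_nonneg hb.le hA₀0)
      have hmain : β * (P₁ * (s * (b * v₂ - β * u₂))) ≤ β * (b * A₀ * (a₀ * V - g₁ * g₂)) := by
        have e1 : β * (P₁ * (s * (b * v₂ - β * u₂))) =
            (a₀ * A₁ - A₀ * v₁) * (s * β) * (b * v₂ - β * u₂) + A₀ * (v₁ - g₁) * (s * β) * (b * v₂ - β * u₂) := by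
          rw [hP₁d]; ring
        have e2 : b * A₀ * ((1 - s) * v₁ * (b * v₂ - β * u₂) + s * β * v₂ * (v₁ - g₁)) =
            b * A₀ * (1 - s) * v₁ * (b * v₂ - β * u₂) + A₀ * (v₁ - g₁) * (s * β) * (b * v₂) := by ring
        have e3 : b * A₀ * (β * (a₀ * V - g₁ * g₂)) = β * (b * A₀ * (a₀ * V - g₁ * g₂)) := by ring
        rw [e1]
        rw [e2, e3] at hsum
        linarith
      have hmain' : P₁ * (s * (b * v₂ - β * u₂)) ≤ b * A₀ * (a₀ * V - g₁ * g₂) := le_of_mul_le_mul_left hmain hβ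
      have hfin := mul_le_mul_of_nonneg_left hmain' hA₀0
      have e4 : A₀ * (P₁ * (s * (b * v₂ - β * u₂))) = P₁ * (s * A₀ * (b * v₂ - β * u₂)) := by ring
      have e5 : A₀ * (b * A₀ * (a₀ * V - g₁ * g₂)) = A₀ ^ 2 * (b * (a₀ * V - g₁ * g₂)) := by ring
      rw [e4, e5] at hfin
      exact hfin
  -- conclusion: multiply the claim by b > 0
  have htot : b * (-(P₁ * P₂)) ≤ b * (a₀ ^ 2 * (A₀ - A₁ * A₂) + A₀ ^ 2 * (a₀ * V - g₁ * g₂)) := by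
    have h1 : b * (-(P₁ * P₂)) = P₁ * (b * (-P₂)) := by ring
    rw [h1]
    calc P₁ * (b * (-P₂)) ≤ P₁ * (s * a₀ * (u₂ - b) + s * A₀ * (b * v₂ - β * u₂)) := mul_le_mul_of_nonneg_left hQ₂ hP₁
      _ = P₁ * (s * a₀ * (u₂ - b)) + P₁ * (s * A₀ * (b * v₂ - β * u₂)) := by ring
      _ ≤ a₀ ^ 2 * (b * (A₀ - A₁ * A₂)) + A₀ ^ 2 * (b * (a₀ * V - g₁ * g₂)) := add_le_add hX hZ
      _ = b * (a₀ ^ 2 * (A₀ - A₁ * A₂) + A₀ ^ 2 * (a₀ * V - g₁ * g₂)) := by ring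
  exact le_of_mul_le_mul_left htot hb

/-- **T-BERN for two petals (the `X¹` coefficient)**: `A₁g₂ + A₂g₁ ≤ a₀ + A₀V`. [this work] -/
theorem k1_pair {s b β V u₁ u₂ v₁ v₂ m₁ m₂ : ℝ} (hb : 0 < b) (hbβ : b ≤ β) (hs0 : 0 ≤ s) (hs1 : s ≤ 1)
    (hu₁ : b ≤ u₁) (hu₁1 : u₁ ≤ 1) (hu₂ : b ≤ u₂) (hu₂1 : u₂ ≤ 1) (hv₁ : β ≤ v₁) (hv₂ : β ≤ v₂)
    (hm₁ : b ≤ m₁) (hm₁u : m₁ ≤ u₁) (hm₁v : m₁ ≤ v₁) (hm₂ : b ≤ m₂) (hm₂u : m₂ ≤ u₂) (hm₂v : m₂ ≤ v₂)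
    (hpu : u₁ * u₂ ≤ b) (hpv : v₁ * v₂ ≤ β * V)
    (hpg : ((1 - s) * m₁ + s * v₁) * ((1 - s) * m₂ + s * v₂) ≤ ((1 - s) * b + s * β) * V) :
    (s + (1 - s) * u₁) * ((1 - s) * m₂ + s * v₂) + (s + (1 - s) * u₂) * ((1 - s) * m₁ + s * v₁) ≤
      ((1 - s) * b + s * β) + (s + (1 - s) * b) * V := by
  set A₀ : ℝ := s + (1 - s) * b with hA₀
  set a₀ : ℝ := (1 - s) * b + s * β with ha₀
  set A₁ : ℝ := s + (1 - s) * u₁ with hA₁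
  set A₂ : ℝ := s + (1 - s) * u₂ with hA₂
  set g₁ : ℝ := (1 - s) * m₁ + s * v₁ with hg₁
  set g₂ : ℝ := (1 - s) * m₂ + s * v₂ with hg₂
  have hs' : 0 ≤ 1 - s := sub_nonneg.2 hs1
  have hsb : 0 ≤ (1 - s) * b := mul_nonneg hs' hb.le
  have hA₀0 : 0 < A₀ := by
    have e : A₀ = b + s * (1 - b) := by rw [hA₀]; ring
    have : 0 ≤ s * (1 - b) := mul_nonneg hs0 (by linarith [hu₁.trans hu₁1])
    rw [e]; linarith
  have ha₀0 : 0 < a₀ := by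
    have : 0 ≤ s * (β - b) := mul_nonneg hs0 (sub_nonneg.2 hbβ)
    have e : a₀ = b + s * (β - b) := by rw [ha₀]; ring
    rw [e]; linarith
  have hAA : A₁ * A₂ ≤ A₀ := A_pair_le hb hs0 hs1 hu₁ hu₂ hu₁1 hpu
  have hid := pair_identity A₀ a₀ A₁ A₂ g₁ g₂
  have hroom : 0 ≤ a₀ ^ 2 * (A₀ - A₁ * A₂) + A₀ ^ 2 * (a₀ * V - g₁ * g₂) :=
    add_nonneg (mul_nonneg (sq_nonneg _) (sub_nonneg.2 hAA)) (mul_nonneg (sq_nonneg _) (sub_nonneg.2 hpg))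
  -- the misalignment product
  have hmis : -((a₀ * A₁ - A₀ * g₁) * (a₀ * A₂ - A₀ * g₂)) ≤ a₀ ^ 2 * (A₀ - A₁ * A₂) + A₀ ^ 2 * (a₀ * V - g₁ * g₂) := by
    rcases le_total 0 (a₀ * A₁ - A₀ * g₁) with h₁ | h₁ <;> rcases le_total 0 (a₀ * A₂ - A₀ * g₂) with h₂ | h₂
    · exact (neg_nonpos.2 (mul_nonneg h₁ h₂)).trans hroom
    · exact k1_pair_misaligned hb hbβ hs0 hs1 hu₁1 hu₂ hv₁ hv₂ hm₁ hm₁v hm₂u hpu hpv hpg h₁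
    · have hpu' : u₂ * u₁ ≤ b := by rw [mul_comm]; exact hpu
      have hpv' : v₂ * v₁ ≤ β * V := by rw [mul_comm]; exact hpv
      have hpg' : g₂ * g₁ ≤ a₀ * V := by rw [mul_comm]; exact hpg
      have key := k1_pair_misaligned (V := V) hb hbβ hs0 hs1 hu₂1 hu₁ hv₂ hv₁ hm₂ hm₂v hm₁u hpu' hpv' hpg' h₂
      have e1 : (a₀ * A₂ - A₀ * g₂) * (a₀ * A₁ - A₀ * g₁) = (a₀ * A₁ - A₀ * g₁) * (a₀ * A₂ - A₀ * g₂) := mul_comm _ _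
      have e2 : A₂ * A₁ = A₁ * A₂ := mul_comm _ _
      have e3 : g₂ * g₁ = g₁ * g₂ := mul_comm _ _
      rw [e1, e2, e3] at key
      exact key
    · exact (neg_nonpos.2 (mul_nonneg_of_nonpos_of_nonpos h₁ h₂)).trans hroom
  have hkey : A₀ * a₀ * (A₁ * g₂ + A₂ * g₁) ≤ A₀ * a₀ * (a₀ + A₀ * V) := by
    have e : A₀ * a₀ * (a₀ + A₀ * V) =
        a₀ ^ 2 * (A₁ * A₂) + A₀ ^ 2 * (g₁ * g₂) + (a₀ ^ 2 * (A₀ - A₁ * A₂) + A₀ ^ 2 * (a₀ * V - g₁ * g₂)) := by ring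
    rw [hid, e]
    linarith
  exact le_of_mul_le_mul_left hkey (mul_pos hA₀0 ha₀0)

/-- **The `CoefDom` certificate of a two-petal family**: `(A₁X+g₁)(A₂X+g₂) ≤_coef (A₀X+a₀)(X+V)`. [this work] -/
theorem coefDom_pair {s b β V u₁ u₂ v₁ v₂ m₁ m₂ : ℝ} (hb : 0 < b) (hbβ : b ≤ β) (hs0 : 0 ≤ s) (hs1 : s ≤ 1)
    (hu₁ : b ≤ u₁) (hu₁1 : u₁ ≤ 1) (hu₂ : b ≤ u₂) (hu₂1 : u₂ ≤ 1) (hv₁ : β ≤ v₁) (hv₂ : β ≤ v₂)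
    (hm₁ : b ≤ m₁) (hm₁u : m₁ ≤ u₁) (hm₁v : m₁ ≤ v₁) (hm₂ : b ≤ m₂) (hm₂u : m₂ ≤ u₂) (hm₂v : m₂ ≤ v₂)
    (hpu : u₁ * u₂ ≤ b) (hpv : v₁ * v₂ ≤ β * V)
    (hpg : ((1 - s) * m₁ + s * v₁) * ((1 - s) * m₂ + s * v₂) ≤ ((1 - s) * b + s * β) * V) :
    CoefDom ((C (s + (1 - s) * u₁) * X + C ((1 - s) * m₁ + s * v₁)) *
        (C (s + (1 - s) * u₂) * X + C ((1 - s) * m₂ + s * v₂)))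
      ((C (s + (1 - s) * b) * X + C ((1 - s) * b + s * β)) * (C 1 * X + C V)) := by
  refine coefDom_step ?_ ?_ ?_
  · rw [mul_one]; exact A_pair_le hb hs0 hs1 hu₁ hu₂ hu₁1 hpu
  · exact hpg
  · have := k1_pair hb hbβ hs0 hs1 hu₁ hu₁1 hu₂ hu₂1 hv₁ hv₂ hm₁ hm₁u hm₁v hm₂ hm₂u hm₂v hpu hpv hpg
    linarith

/-- **T-BERN on `Fin 2`**: every admissible two-petal family satisfies the conclusion of `TBern s b β V`. [this work] -/
theorem tbern_fin_two {s b β V : ℝ} (hb : 0 < b) (hbβ : b ≤ β) (hs0 : 0 ≤ s) (hs1 : s ≤ 1)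
    (u vv m : Fin 2 → ℝ) (hub : ∀ j, b ≤ u j) (hu1 : ∀ j, u j ≤ 1) (hvβ : ∀ j, β ≤ vv j)
    (hmb : ∀ j, b ≤ m j) (hmu : ∀ j, m j ≤ u j) (hmv : ∀ j, m j ≤ vv j)
    (hpu : ∏ j, u j ≤ b ^ (2 - 1)) (hpv : ∏ j, vv j ≤ β ^ (2 - 1) * V)
    (hpg : ∏ j, ((1 - s) * m j + s * vv j) ≤ ((1 - s) * b + s * β) ^ (2 - 1) * V) (k : ℕ) :
    tcoeff (univ : Finset (Fin 2)) (fun j => s + (1 - s) * u j) (fun j => (1 - s) * m j + s * vv j) k ≤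
      tcoeff (univ : Finset (Fin 2)) (fullFloorA s b) (fullFloorG s b β V) k := by
  refine tbern_le_of_coefDom (by norm_num) u vv m ?_ k
  have h21 : (2 : ℕ) - 1 = 1 := rfl
  rw [h21, pow_one] at hpu hpv hpg ⊢
  rw [Fin.prod_univ_two] at hpu hpv hpg
  unfold prodPoly
  rw [Fin.prod_univ_two]
  exact coefDom_pair hb hbβ hs0 hs1 (hub 0) (hu1 0) (hub 1) (hu1 1) (hvβ 0) (hvβ 1) (hmb 0) (hmu 0) (hmv 0)
    (hmb 1) (hmu 1) (hmv 1) hpu hpv hpg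

end LinkedCurrency

end SafeCalc

end Summit.CriticalPhenomena.PercolationContinuityZ3.Theorems.SunflowerPartition
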